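import Mathlib
import Literature.RingTheory.CohomologyAnnihilator.Localization
import Literature.RingTheory.CohomologyAnnihilator.SyzygyBaseChange
import Literature.RingTheory.CohomologyAnnihilator.SyzygyDescent
import Literature.RingTheory.CohomologyAnnihilator.TowerRestrict
import Literature.RingTheory.CohomologyAnnihilator.TowerSyzygy
import Summits.ResolutionOfSingularities.ResolutionOfSingularities.Theorems.HomologicalConductorPersistenceSurfaceCompleteHerzogTransfer
import HarnessLib

/-!
# Rung S-2 `PersistenceSurface` (stmt-ResolutionOfSingularities-19970), stub C1 (`Sat₄`) — «LOCAL HERZOG FROM GLOBAL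
# HERZOG»: an `add`-cover of the second syzygies LOCALISES

[OURS · cell decomp-res · rung S-2; seat leafhand-res-homologicalconduct-15 gen 0]  Nothing here is a statement of the
manuscript under review (Hironaka 2017); AI-written, weaker than expert review.  DEF-FREE.

Brick (iii) of the level-exact completion transport of the toric `Sat₄` theorem (evidence HAND15-TRANSPORT §3): for a
noetherian ring `R`, a multiplicative set `P` and an `R`-module `V` with `R ∈ add V` (e.g. `V = k[u,v]|_U` and the Reynolds
retraction), if every second syzygy module of a finitely generated `R`-module is a retract of a power of `V`, then every
second syzygy module over `R_P = Localization P` is a retract of a power of `R_P ⊗_R V`.  Mechanism: a finitely generated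
`R_P`-module is `R_P ⊗ M` with `M` finitely generated over `R` (`exists_iso_localizedModule`); a second syzygy `K` of `M`
base-changes to a second syzygy of `R_P ⊗ M` (`IsSyzygy.baseChange`, `R_P` flat); Schanuel (`IsSyzygy.exists_stablyIso`)
makes the given second syzygy `K'` a retract of `(R_P ⊗ K) ⊕ P₁` with `P₁` finitely generated projective; and
`R_P ⊗ K ∈ add(R_P ⊗ V)` (`isRetractOfPower_baseChange`), `P₁ ∈ add R_P ⊆ add(R_P ⊗ V)`.

* `isRetractOfPower_of_isSyzygy_two_localization` — THE TRANSFER.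

With `…CompleteHerzogTransfer.isRetractOfPower_of_isSyzygy_two_of_completionLike` (this seat) the chain
«graded/affine Herzog ⇒ local Herzog ⇒ complete Herzog» is formal; the remaining input for the toric class is the
certificate rerun over the completion (Wunram law and Ω-stability by base change).

References: S. B. Iyengar, R. Takahashi, IMRN 2016, Def. 4.1, Lemma 2.10 [`IyengarTakahashi2014`]; H. Matsumura,
*Commutative Ring Theory*, §19 Lemma 3 (Schanuel) [`Matsumura1987`] — tree lemmas only.
-/

-- single-problem summit: the doubled namespace component `ResolutionOfSingularities` is forced
set_option linter.dupNamespace false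

noncomputable section

open CategoryTheory TensorProduct Literature.RingTheory.CohomologyAnnihilator
open Summit.ResolutionOfSingularities.ResolutionOfSingularities.Theorems.HomologicalConductor.PersistenceSurfaceCompleteHerzogTransfer
  (isRetractOfPower_baseChange)

universe u

namespace Summit.ResolutionOfSingularities.ResolutionOfSingularities.Theorems.HomologicalConductor.PersistenceSurfaceLocalHerzogTransfer

/-- **LOCAL HERZOG FROM GLOBAL HERZOG.**  `R` noetherian, `P ⊆ R` multiplicative, `V` an `R`-module with `R ∈ add V`;
if every second syzygy module (of a finitely generated module) over `R` lies in `add V`, then every second syzygy module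
over `Localization P` lies in `add (Localization P ⊗_R V)`. [OURS · cell decomp-res] -/
theorem isRetractOfPower_of_isSyzygy_two_localization {R : Type u} [CommRing R] [IsNoetherianRing R]
    (P : Submonoid R) (V : ModuleCat.{u} R) (hR : IsRetractOfPower V (ModuleCat.of R R))
    (hHerzog : ∀ (M K : ModuleCat.{u} R), Module.Finite R M → IsSyzygy 2 M K → IsRetractOfPower V K)
    (M' K' : ModuleCat.{u} (Localization P)) [Module.Finite (Localization P) M'] (hK' : IsSyzygy 2 M' K') :
    IsRetractOfPower (ModuleCat.of (Localization P) (Localization P ⊗[R] V)) K' := by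
  -- `M' ≅ R_P ⊗ M` with `M` finitely generated over `R`
  letI : Module R M' := Module.compHom M' (algebraMap R (Localization P))
  haveI : IsScalarTower R (Localization P) M' := IsScalarTower.of_algebraMap_smul fun _ _ => rfl
  obtain ⟨M, hM, ⟨α⟩⟩ := exists_iso_localizedModule P M'
  haveI := hM
  let eβ : Localization P ⊗[R] M ≃ₗ[Localization P] M.localizedModule P :=
    (IsLocalizedModule.isBaseChange P (Localization P) (M.localizedModuleMkLinearMap P)).equiv
  let e : ModuleCat.of (Localization P) (Localization P ⊗[R] M) ≅ M' := eβ.toModuleIso ≪≫ α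
  -- a second syzygy `K` of `M` over `R`
  obtain ⟨K₁, hK₁⟩ := exists_isSyzygy_one M
  haveI : Module.Finite R K₁ := finite_of_isSyzygy 1 hM hK₁
  obtain ⟨K, hK⟩ := exists_isSyzygy_one K₁
  have hK2 : IsSyzygy 2 M K := isSyzygy_succ_iff_exists_first.mpr ⟨K₁, hK₁, hK⟩
  -- base change to `R_P` (flat) and transport along `e`
  haveI : Module.Flat R (Localization P) := IsLocalization.flat (Localization P) P
  have hKL : IsSyzygy 2 M' (ModuleCat.of (Localization P) (Localization P ⊗[R] K)) :=
    (IsSyzygy.baseChange (Localization P) 2 hK2).of_iso_base e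
  -- Schanuel: `K' ⊕ P₂ ≅ (R_P ⊗ K) ⊕ P₁`
  obtain ⟨P₁, P₂, hP₁, hproj₁, hP₂, hproj₂, ⟨ι⟩⟩ := IsSyzygy.exists_stablyIso hK' hKL
  -- the generator `R_P ⊗ V` covers `R_P ⊗ K`, `R_P`, and `P₁`
  have hLK : IsRetractOfPower (ModuleCat.of (Localization P) (Localization P ⊗[R] V))
      (ModuleCat.of (Localization P) (Localization P ⊗[R] K)) :=
    isRetractOfPower_baseChange (Localization P) (hHerzog M K hM hK2)
  have hL : IsRetractOfPower (ModuleCat.of (Localization P) (Localization P ⊗[R] V))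
      (ModuleCat.of (Localization P) (Localization P)) :=
    (isRetractOfPower_baseChange (Localization P) hR).of_iso
      (AlgebraTensorModule.rid R (Localization P) (Localization P)).toModuleIso
  have hP₁' : IsRetractOfPower (ModuleCat.of (Localization P) (Localization P ⊗[R] V)) P₁ :=
    IsRetractOfPower.of_projective hL hP₁ hproj₁
  have hsum := (hLK.prod hP₁').of_iso ι.symm
  exact hsum.of_retract (ModuleCat.ofHom (LinearMap.inl (Localization P) K' P₂))
    (ModuleCat.ofHom (LinearMap.fst (Localization P) K' P₂))
    (by apply ModuleCat.hom_ext; exact LinearMap.ext fun _ => rfl)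

end Summit.ResolutionOfSingularities.ResolutionOfSingularities.Theorems.HomologicalConductor.PersistenceSurfaceLocalHerzogTransfer

end
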